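import Literature.Geometry.Lorentzian.KerrStarEnergyIdentity
import HarnessLib

/-!
# Multiplier identities for the Kerr wave equation in the coordinates `(t*, r, θ, φ*)` on
# axisymmetric functions: the currents of `X = f(r)∂_r + h(r)∂_{t*}` with a Lagrangian term
# `w(r)`, their pointwise divergence identities, and the identity on coordinate boxes

(family `gr`; namespace `Literature.Geometry.Lorentzian.Kerr.StarCoord`; written from the proving
seat of `Literature.Barriers.FinalStateConjecture.Aretakis2012_pointwiseDecay` — Aretakis, JFA 263
(2012), Thm. 5. By `ExtremalHorizonPointwiseDecayFromEnergy.lean` that named fact rests on the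
uniform boundedness and integrated local energy decay statements of the paper (Thms. 1–2), whose
physical-space proofs (§§8–13 of the source) consist of energy identities for currents
`J^{X,w}_μ = T_{μν}X^ν + w ψ∂_μψ − ½(∂_μw)ψ²` with vector fields `X = f ∂_{r*}` (§§8–11), `T`, the
red-shift-type fields near `𝓗⁺` (§12–13), all with coefficients depending on `r` only, followed by
positivity arguments for the bulk terms. **This file supplies the identities** — the algebraic and
Stokes part of the method — in the coordinates in which the paper writes them, for functions with
`∂_{φ*} = 0` (`ρ²□_g = 𝓡 + 𝓐`, `radOp`/`angOp` of `KerrCarterCommutation.lean`), leaving to the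
estimates proper only the choice of `f, h, w` and the signs.)

* `box_divergence_identity` (**Stokes on coordinate boxes**): for smooth `e, f, g` and continuous `b`
  on an open `W₀ ⊇ [t₁, t₂] × [r₁, r₂] × [0, π]` (at fixed `φ₀`, `boxPoint`) with
  `∂_{t*}e + b = ∂_r f + ∂_θ g` on `W₀`:
  `∫∫e(t₂) − ∫∫e(t₁) + ∫∫∫ b = ∫∫ (f(r₂) − f(r₁)) + ∫∫ (g(π) − g(0))`
  (fundamental theorem of calculus in each variable, Fubini for continuous integrands via clamped
  composites; generalises `tEnergy_box_identity` of `KerrStarEnergyIdentity.lean`);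
* `radMultDensity/FluxR/FluxTheta/Bulk` and `radMult_identity` (**`X = f(r)∂_r`**):
  `sin θ f ∂_rG (𝓡G + 𝓐G) = ∂_{t*}e_f + ∂_r f_f + ∂_θ(sin θ f ∂_rG∂_θG) + bulk_f`, with
  `e_f = sin θ f (2Mr(∂_rG)² − (ρ² + 2Mr)∂_rG∂_{t*}G)`,
  `f_f = ½ sin θ f (Δ(∂_rG)² + (ρ² + 2Mr)(∂_{t*}G)² − (∂_θG)²)`,
  `bulk_f = ½ sin θ [(fΔ' − f'Δ)(∂_rG)² + 4Mf ∂_{t*}G∂_rG − (f'(ρ² + 2Mr) + f(2r + 2M))(∂_{t*}G)² + f'(∂_θG)²]`;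
* `timeMultDensity/FluxR/FluxTheta` and `timeMult_identity` (**`X = h(r)∂_{t*}`**): the current is
  `h J^T`, bulk `−h' f_T` (from `tEnergy_identity`);
* `lagDensity/FluxR/FluxTheta/Bulk` and `lag_identity` (**the Lagrangian term `w(r)`**):
  `sin θ w G (𝓡G + 𝓐G) = ∂_{t*}e_w + ∂_r f_w + ∂_θ(sin θ w G∂_θG) + bulk_w`,
  `bulk_w = sin θ [−wΔ(∂_rG)² + ½(w''Δ + w'Δ')G² − 4Mr w ∂_{t*}G∂_rG + (ρ² + 2Mr) w (∂_{t*}G)² − w(∂_θG)²]`;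
* `multDensity/FluxR/FluxTheta/Bulk`, `contDiffOn_mult`, `mult_divergence_eq_zero` (**for
  solutions, at every point**: off the axis by the three identities and `𝓡G + 𝓐G = 0`, on the axis
  by continuity — `eq_zero_of_eq_zero_offAxis`) and `mult_box_identity` (**the energy identity of
  `J^{X,w}` on the region between two leaves and two cylinders**):
  `∫∫e(t₂) − ∫∫e(t₁) + ∫∫∫ bulk + ∫∫ (F(r₂) − F(r₁)) = 0` for smooth radial profiles `f, h, w`
  (the polar fluxes vanish at the poles).

Here `Δ = r² − 2Mr + a²`, `ρ² + 2Mr = r² + a²cos²θ + 2Mr`, and all densities carry the factor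
`sin θ` of the volume form `ρ² sin θ dr dθ dφ*` (the `ρ²` being in the operator). Everything is
proved (product rule, symmetry of mixed partials, `sin² + cos² = 1`); no named facts. On extremal
Kerr `a = M` the horizon `{r = M}` is a face `r₁ = M` of the box, where `Δ = 0` kills the
transversal terms of the fluxes (cf. `tFluxR_extremal_horizon`); the outer face is disposed of by
`Kerr.fderiv_shellPoint_eq_zero_of_far` (`ExtremalHorizonFiniteSpeed.lean`).

## References

* S. Aretakis, *Decay of axisymmetric solutions of the wave equation on extreme Kerr backgrounds*,
  J. Funct. Anal. 263 (2012) 2770–2831 (arXiv:1110.2006): §5.2 (the vector field method: the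
  currents `J^V`, `K^V`, the Lagrangian modification), §8 (the vector fields `X = f(r*)∂_{r*}` and
  the currents `J^{X, …}` of the integrated decay estimates), §§9–13 (key `Aretakis2012`).
* M. Dafermos, I. Rodnianski, *Lectures on black holes and linear waves*, arXiv:0811.0354, App. D
  (`J^V_μ = T_{μν}V^ν`, `K^V = ½T^{μν}π^V_{μν}`, `𝓔^V`, modified currents, and the divergence
  theorem) (key `DafermosRodnianski2008`).
-/

noncomputable section

open Real Set Filter
open scoped Topology ContDiff

namespace Literature.Geometry.Lorentzian

namespace Kerr

namespace StarCoord

/-! ### The generic divergence identity on a coordinate box -/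

section BoxDivergence

/-- Clamped composites are globally continuous (restated with `ContinuousOn` input, for use in
this file; cf. `continuous_clampedComp`). [folklore] -/
private theorem clamp_eq' {a b x : ℝ} (hx : x ∈ Icc a b) : max a (min x b) = x := by
  rw [min_eq_left hx.2, max_eq_right hx.1]

/-- Fubini for a continuous integrand on a rectangle (private duplicate, cf.
`KerrStarEnergyIdentity.lean`). [folklore] -/
private theorem swap_continuous {f : ℝ → ℝ → ℝ} (hf : Continuous (Function.uncurry f))
    {a b c d : ℝ} (hab : a ≤ b) (hcd : c ≤ d) :
    ∫ x in a..b, ∫ y in c..d, f x y = ∫ y in c..d, ∫ x in a..b, f x y := by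
  simp only [intervalIntegral.integral_of_le hab, intervalIntegral.integral_of_le hcd]
  have hint : MeasureTheory.Integrable (Function.uncurry f)
      (((MeasureTheory.volume : MeasureTheory.Measure ℝ).restrict (Ioc a b)).prod
        ((MeasureTheory.volume : MeasureTheory.Measure ℝ).restrict (Ioc c d))) := by
    rw [MeasureTheory.Measure.prod_restrict, ← MeasureTheory.Measure.volume_eq_prod]
    exact (hf.continuousOn.integrableOn_compact (isCompact_Icc.prod isCompact_Icc)).mono_set
      (Set.prod_mono Ioc_subset_Icc_self Ioc_subset_Icc_self)
  exact MeasureTheory.integral_integral_swap hint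

/-- **The divergence identity on a coordinate box** `[t₁, t₂] × [r₁, r₂] × [0, π]` (at fixed `φ₀`).
Let `e, f, g` be smooth and `b` continuous on an open set `W₀` of coordinate space containing the
box, with `∂_{t*} e + b = ∂_r f + ∂_θ g` on `W₀` (a current `(e, f, g)` in the coordinates
`(t*, r, θ)` with bulk `−b`). Then
`∫₀^π∫_{r₁}^{r₂} e(t₂) − ∫₀^π∫_{r₁}^{r₂} e(t₁) + ∫_{t₁}^{t₂}∫₀^π∫_{r₁}^{r₂} b
   = ∫_{t₁}^{t₂}∫₀^π (f(t, r₂, θ) − f(t, r₁, θ)) dθ dt + ∫_{t₁}^{t₂}∫_{r₁}^{r₂} (g(t, r, π) − g(t, r, 0)) dr dt`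
— Stokes' theorem for the current on the box (Dafermos–Rodnianski, arXiv:0811.0354, App. D: the
energy identity `∫_{Σ₂} J·n + ∫_𝓑 K = ∫_{Σ₁} J·n + boundary fluxes` for a multiplier current with
bulk `K`), proved by the fundamental theorem of calculus in `t`, `r`, `θ` and Fubini for continuous
integrands. The `T`-energy identity `tEnergy_box_identity` is the case `b = 0`, `g = sin θ ∂_θG ∂_{t*}G`.
[cite: DafermosRodnianski2008, App. D] -/
theorem box_divergence_identity {W₀ : Set E4} (hW₀ : IsOpen W₀) {e f g b : E4 → ℝ}
    (he : ContDiffOn ℝ ∞ e W₀) (hf : ContDiffOn ℝ ∞ f W₀) (hg : ContDiffOn ℝ ∞ g W₀)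
    (hb : ContinuousOn b W₀)
    (hid : ∀ q ∈ W₀, pd 0 e q + b q = pd 1 f q + pd 2 g q)
    {t₁ t₂ r₁ r₂ φ₀ : ℝ} (ht : t₁ ≤ t₂) (hr : r₁ ≤ r₂)
    (hbox : ∀ t ∈ Icc t₁ t₂, ∀ r ∈ Icc r₁ r₂, ∀ θ ∈ Icc 0 π, boxPoint φ₀ t r θ ∈ W₀) :
    (∫ θ in (0 : ℝ)..π, ∫ r in r₁..r₂, e (boxPoint φ₀ t₂ r θ)) -
        (∫ θ in (0 : ℝ)..π, ∫ r in r₁..r₂, e (boxPoint φ₀ t₁ r θ)) +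
        (∫ t in t₁..t₂, ∫ θ in (0 : ℝ)..π, ∫ r in r₁..r₂, b (boxPoint φ₀ t r θ)) =
      (∫ t in t₁..t₂, ∫ θ in (0 : ℝ)..π, (f (boxPoint φ₀ t r₂ θ) - f (boxPoint φ₀ t r₁ θ))) +
        ∫ t in t₁..t₂, ∫ r in r₁..r₂, (g (boxPoint φ₀ t r π) - g (boxPoint φ₀ t r 0)) := by
  have hπ : (0 : ℝ) ≤ π := pi_pos.le
  -- continuity on `W₀` and differentiability at its points
  have ce : ContinuousOn e W₀ := he.continuousOn
  have cf : ContinuousOn f W₀ := hf.continuousOn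
  have cg : ContinuousOn g W₀ := hg.continuousOn
  have cdf : ContinuousOn (pd 1 f) W₀ := (contDiffOn_pd hW₀ hf 1).continuousOn
  have cdg : ContinuousOn (pd 2 g) W₀ := (contDiffOn_pd hW₀ hg 2).continuousOn
  have de : ∀ q ∈ W₀, DifferentiableAt ℝ e q := fun q hq ↦
    (he.contDiffAt (hW₀.mem_nhds hq)).differentiableAt (by simp)
  have df : ∀ q ∈ W₀, DifferentiableAt ℝ f q := fun q hq ↦
    (hf.contDiffAt (hW₀.mem_nhds hq)).differentiableAt (by simp)
  have dg : ∀ q ∈ W₀, DifferentiableAt ℝ g q := fun q hq ↦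
    (hg.contDiffAt (hW₀.mem_nhds hq)).differentiableAt (by simp)
  -- clamps are the identity on the box
  have ct_eq : ∀ t ∈ Icc t₁ t₂, max t₁ (min t t₂) = t := fun t ht' ↦ clamp_eq' ht'
  have cr_eq : ∀ r ∈ Icc r₁ r₂, max r₁ (min r r₂) = r := fun r hr' ↦ clamp_eq' hr'
  have cθ_eq : ∀ θ ∈ Icc (0 : ℝ) π, max 0 (min θ π) = θ := fun θ hθ ↦ clamp_eq' hθ
  have ht₁ : t₁ ∈ Icc t₁ t₂ := left_mem_Icc.mpr ht
  have ht₂ : t₂ ∈ Icc t₁ t₂ := right_mem_Icc.mpr ht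
  have hr₁ : r₁ ∈ Icc r₁ r₂ := left_mem_Icc.mpr hr
  have hr₂ : r₂ ∈ Icc r₁ r₂ := right_mem_Icc.mpr hr
  have h0π : (0 : ℝ) ∈ Icc (0 : ℝ) π := left_mem_Icc.mpr hπ
  have hππ : π ∈ Icc (0 : ℝ) π := right_mem_Icc.mpr hπ
  -- clamped, globally continuous integrands
  obtain ⟨cE, hcE⟩ : ∃ F : ℝ → ℝ → ℝ → ℝ, F = fun t r θ ↦
      e (boxPoint φ₀ (max t₁ (min t t₂)) (max r₁ (min r r₂)) (max 0 (min θ π))) := ⟨_, rfl⟩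
  obtain ⟨gF, hgF⟩ : ∃ F : ℝ → ℝ → ℝ → ℝ, F = fun t r θ ↦
      pd 1 f (boxPoint φ₀ (max t₁ (min t t₂)) (max r₁ (min r r₂)) (max 0 (min θ π))) := ⟨_, rfl⟩
  obtain ⟨gΘ, hgΘ⟩ : ∃ F : ℝ → ℝ → ℝ → ℝ, F = fun t r θ ↦
      pd 2 g (boxPoint φ₀ (max t₁ (min t t₂)) (max r₁ (min r r₂)) (max 0 (min θ π))) := ⟨_, rfl⟩
  obtain ⟨gb, hgb⟩ : ∃ F : ℝ → ℝ → ℝ → ℝ, F = fun t r θ ↦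
      b (boxPoint φ₀ (max t₁ (min t t₂)) (max r₁ (min r r₂)) (max 0 (min θ π))) := ⟨_, rfl⟩
  obtain ⟨fF, hfF⟩ : ∃ F : ℝ → ℝ → ℝ → ℝ, F = fun t r θ ↦
      f (boxPoint φ₀ (max t₁ (min t t₂)) (max r₁ (min r r₂)) (max 0 (min θ π))) := ⟨_, rfl⟩
  obtain ⟨fG, hfG⟩ : ∃ F : ℝ → ℝ → ℝ → ℝ, F = fun t r θ ↦
      g (boxPoint φ₀ (max t₁ (min t t₂)) (max r₁ (min r r₂)) (max 0 (min θ π))) := ⟨_, rfl⟩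
  have ccE : Continuous fun p : ℝ × ℝ × ℝ ↦ cE p.1 p.2.1 p.2.2 := by
    rw [hcE]; exact continuous_clampedComp ce ht hr hbox
  have cgF : Continuous fun p : ℝ × ℝ × ℝ ↦ gF p.1 p.2.1 p.2.2 := by
    rw [hgF]; exact continuous_clampedComp cdf ht hr hbox
  have cgΘ : Continuous fun p : ℝ × ℝ × ℝ ↦ gΘ p.1 p.2.1 p.2.2 := by
    rw [hgΘ]; exact continuous_clampedComp cdg ht hr hbox
  have cgb : Continuous fun p : ℝ × ℝ × ℝ ↦ gb p.1 p.2.1 p.2.2 := by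
    rw [hgb]; exact continuous_clampedComp hb ht hr hbox
  have cfF : Continuous fun p : ℝ × ℝ × ℝ ↦ fF p.1 p.2.1 p.2.2 := by
    rw [hfF]; exact continuous_clampedComp cf ht hr hbox
  have cfG : Continuous fun p : ℝ × ℝ × ℝ ↦ fG p.1 p.2.1 p.2.2 := by
    rw [hfG]; exact continuous_clampedComp cg ht hr hbox
  -- the coordinate embeddings used to slice these functions
  have m_t : ∀ r θ : ℝ, Continuous fun t : ℝ ↦ ((t, r, θ) : ℝ × ℝ × ℝ) := fun r θ ↦
    Continuous.prodMk continuous_id continuous_const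
  have m_r : ∀ t θ : ℝ, Continuous fun r : ℝ ↦ ((t, r, θ) : ℝ × ℝ × ℝ) := fun t θ ↦
    Continuous.prodMk continuous_const (Continuous.prodMk continuous_id continuous_const)
  have m_θ : ∀ t r : ℝ, Continuous fun θ : ℝ ↦ ((t, r, θ) : ℝ × ℝ × ℝ) := fun t r ↦
    Continuous.prodMk continuous_const (Continuous.prodMk continuous_const continuous_id)
  have m_θr : ∀ t : ℝ, Continuous fun p : ℝ × ℝ ↦ ((t, p.2, p.1) : ℝ × ℝ × ℝ) := fun t ↦
    Continuous.prodMk continuous_const (Continuous.prodMk continuous_snd continuous_fst)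
  have m_rt : ∀ θ : ℝ, Continuous fun p : ℝ × ℝ ↦ ((p.2, p.1, θ) : ℝ × ℝ × ℝ) := fun θ ↦
    Continuous.prodMk continuous_snd (Continuous.prodMk continuous_fst continuous_const)
  have m_θt : ∀ r : ℝ, Continuous fun p : ℝ × ℝ ↦ ((p.2, r, p.1) : ℝ × ℝ × ℝ) := fun r ↦
    Continuous.prodMk continuous_snd (Continuous.prodMk continuous_const continuous_fst)
  have m_tr : ∀ θ : ℝ, Continuous fun p : ℝ × ℝ ↦ ((p.1, p.2, θ) : ℝ × ℝ × ℝ) := fun θ ↦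
    Continuous.prodMk continuous_fst (Continuous.prodMk continuous_snd continuous_const)
  have m_rθt : Continuous fun p : (ℝ × ℝ) × ℝ ↦ ((p.2, p.1.1, p.1.2) : ℝ × ℝ × ℝ) :=
    Continuous.prodMk continuous_snd (Continuous.prodMk (continuous_fst.comp continuous_fst)
      (continuous_snd.comp continuous_fst))
  have m_θtr : Continuous fun p : (ℝ × ℝ) × ℝ ↦ ((p.1.2, p.2, p.1.1) : ℝ × ℝ × ℝ) :=
    Continuous.prodMk (continuous_snd.comp continuous_fst) (Continuous.prodMk continuous_snd
      (continuous_fst.comp continuous_fst))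
  /- Step 1: fundamental theorem of calculus in `t`, pointwise in `(r, θ)` of the box -/
  have step1 : ∀ r ∈ Icc r₁ r₂, ∀ θ ∈ Icc (0 : ℝ) π,
      e (boxPoint φ₀ t₂ r θ) - e (boxPoint φ₀ t₁ r θ) =
        ∫ t in t₁..t₂, (gF t r θ + gΘ t r θ - gb t r θ) := by
    intro r hr' θ hθ
    have hderiv : ∀ t ∈ uIcc t₁ t₂, HasDerivAt (fun t' ↦ e (boxPoint φ₀ t' r θ))
        (gF t r θ + gΘ t r θ - gb t r θ) t := by
      intro t ht'
      rw [uIcc_of_le ht] at ht'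
      have hq := hbox t ht' r hr' θ hθ
      have h := hasDerivAt_comp_boxPoint_t (de _ hq)
      have hval : pd 0 e (boxPoint φ₀ t r θ) = gF t r θ + gΘ t r θ - gb t r θ := by
        have := hid _ hq
        simp only [hgF, hgΘ, hgb, ct_eq t ht', cr_eq r hr', cθ_eq θ hθ]
        linarith
      rw [hval] at h
      exact h
    have hc1 : Continuous fun t ↦ gF t r θ := cgF.comp (m_t r θ)
    have hc2 : Continuous fun t ↦ gΘ t r θ := cgΘ.comp (m_t r θ)
    have hc3 : Continuous fun t ↦ gb t r θ := cgb.comp (m_t r θ)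
    have hcont : Continuous fun t ↦ gF t r θ + gΘ t r θ - gb t r θ := (hc1.add hc2).sub hc3
    rw [intervalIntegral.integral_eq_sub_of_hasDerivAt hderiv (hcont.intervalIntegrable _ _)]
  /- Step 2: the energy difference as a box integral of the `t`-integrals -/
  have heint : ∀ t ∈ Icc t₁ t₂, (∫ θ in (0 : ℝ)..π, ∫ r in r₁..r₂, e (boxPoint φ₀ t r θ)) =
      ∫ θ in (0 : ℝ)..π, ∫ r in r₁..r₂, cE t r θ := by
    intro t ht'
    refine intervalIntegral.integral_congr fun θ hθ ↦ ?_
    rw [uIcc_of_le hπ] at hθ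
    refine intervalIntegral.integral_congr fun r hr' ↦ ?_
    rw [uIcc_of_le hr] at hr'
    simp only [hcE, ct_eq t ht', cr_eq r hr', cθ_eq θ hθ]
  have cE_r : ∀ t θ, Continuous fun r ↦ cE t r θ := fun t θ ↦ ccE.comp (m_r t θ)
  have cE_θ : ∀ t, Continuous fun θ ↦ ∫ r in r₁..r₂, cE t r θ := by
    intro t
    have h : Continuous (Function.uncurry fun θ r ↦ cE t r θ) := ccE.comp (m_θr t)
    exact intervalIntegral.continuous_parametric_intervalIntegral_of_continuous' h r₁ r₂
  have hlhs : (∫ θ in (0 : ℝ)..π, ∫ r in r₁..r₂, e (boxPoint φ₀ t₂ r θ)) -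
      (∫ θ in (0 : ℝ)..π, ∫ r in r₁..r₂, e (boxPoint φ₀ t₁ r θ)) =
      ∫ θ in (0 : ℝ)..π, ∫ r in r₁..r₂, ∫ t in t₁..t₂, (gF t r θ + gΘ t r θ - gb t r θ) := by
    rw [heint t₂ ht₂, heint t₁ ht₁,
      ← intervalIntegral.integral_sub ((cE_θ t₂).intervalIntegrable _ _) ((cE_θ t₁).intervalIntegrable _ _)]
    refine intervalIntegral.integral_congr fun θ hθ ↦ ?_
    rw [uIcc_of_le hπ] at hθ
    rw [← intervalIntegral.integral_sub ((cE_r t₂ θ).intervalIntegrable _ _)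
      ((cE_r t₁ θ).intervalIntegrable _ _)]
    refine intervalIntegral.integral_congr fun r hr' ↦ ?_
    rw [uIcc_of_le hr] at hr'
    rw [← step1 r hr' θ hθ]
    simp only [hcE, ct_eq t₂ ht₂, ct_eq t₁ ht₁, cr_eq r hr', cθ_eq θ hθ]
  /- Step 3: split into the three terms -/
  have c_t : ∀ (F : ℝ → ℝ → ℝ → ℝ), (Continuous fun p : ℝ × ℝ × ℝ ↦ F p.1 p.2.1 p.2.2) →
      ∀ r θ, Continuous fun t ↦ F t r θ := fun F hF r θ ↦ hF.comp (m_t r θ)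
  have cI_r : ∀ (F : ℝ → ℝ → ℝ → ℝ), (Continuous fun p : ℝ × ℝ × ℝ ↦ F p.1 p.2.1 p.2.2) →
      ∀ θ, Continuous fun r ↦ ∫ t in t₁..t₂, F t r θ := by
    intro F hF θ
    have h : Continuous (Function.uncurry fun r t ↦ F t r θ) := hF.comp (m_rt θ)
    exact intervalIntegral.continuous_parametric_intervalIntegral_of_continuous' h t₁ t₂
  have cI_rθ : ∀ (F : ℝ → ℝ → ℝ → ℝ), (Continuous fun p : ℝ × ℝ × ℝ ↦ F p.1 p.2.1 p.2.2) →
      Continuous fun p : ℝ × ℝ ↦ ∫ t in t₁..t₂, F t p.1 p.2 := by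
    intro F hF
    have h : Continuous (Function.uncurry fun (p : ℝ × ℝ) t ↦ F t p.1 p.2) := hF.comp m_rθt
    exact intervalIntegral.continuous_parametric_intervalIntegral_of_continuous' h t₁ t₂
  have cI_θ : ∀ (F : ℝ → ℝ → ℝ → ℝ), (Continuous fun p : ℝ × ℝ × ℝ ↦ F p.1 p.2.1 p.2.2) →
      Continuous fun θ ↦ ∫ r in r₁..r₂, ∫ t in t₁..t₂, F t r θ := by
    intro F hF
    have h : Continuous (Function.uncurry fun θ r ↦ ∫ t in t₁..t₂, F t r θ) :=
      (cI_rθ F hF).comp (Continuous.prodMk continuous_snd continuous_fst)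
    exact intervalIntegral.continuous_parametric_intervalIntegral_of_continuous' h r₁ r₂
  have cS1 : ∀ r θ, Continuous fun t ↦ gF t r θ + gΘ t r θ := fun r θ ↦
    (c_t gF cgF r θ).add (c_t gΘ cgΘ r θ)
  have cS2 : ∀ θ, Continuous fun r ↦ (∫ t in t₁..t₂, gF t r θ) + ∫ t in t₁..t₂, gΘ t r θ := fun θ ↦
    (cI_r gF cgF θ).add (cI_r gΘ cgΘ θ)
  have cS3 : Continuous fun θ ↦ (∫ r in r₁..r₂, ∫ t in t₁..t₂, gF t r θ) +
      ∫ r in r₁..r₂, ∫ t in t₁..t₂, gΘ t r θ := (cI_θ gF cgF).add (cI_θ gΘ cgΘ)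
  have e1 : ∀ r θ, (∫ t in t₁..t₂, (gF t r θ + gΘ t r θ - gb t r θ)) =
      ((∫ t in t₁..t₂, gF t r θ) + ∫ t in t₁..t₂, gΘ t r θ) - ∫ t in t₁..t₂, gb t r θ := by
    intro r θ
    rw [intervalIntegral.integral_sub ((cS1 r θ).intervalIntegrable _ _)
        ((c_t gb cgb r θ).intervalIntegrable _ _),
      intervalIntegral.integral_add ((c_t gF cgF r θ).intervalIntegrable _ _)
        ((c_t gΘ cgΘ r θ).intervalIntegrable _ _)]
  have e2 : ∀ θ, (∫ r in r₁..r₂, (((∫ t in t₁..t₂, gF t r θ) + ∫ t in t₁..t₂, gΘ t r θ) -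
      ∫ t in t₁..t₂, gb t r θ)) =
      ((∫ r in r₁..r₂, ∫ t in t₁..t₂, gF t r θ) + ∫ r in r₁..r₂, ∫ t in t₁..t₂, gΘ t r θ) -
        ∫ r in r₁..r₂, ∫ t in t₁..t₂, gb t r θ := by
    intro θ
    rw [intervalIntegral.integral_sub ((cS2 θ).intervalIntegrable _ _)
        ((cI_r gb cgb θ).intervalIntegrable _ _),
      intervalIntegral.integral_add ((cI_r gF cgF θ).intervalIntegrable _ _)
        ((cI_r gΘ cgΘ θ).intervalIntegrable _ _)]
  have hsplit : (∫ θ in (0 : ℝ)..π, ∫ r in r₁..r₂, ∫ t in t₁..t₂, (gF t r θ + gΘ t r θ - gb t r θ)) =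
      (∫ θ in (0 : ℝ)..π, ∫ r in r₁..r₂, ∫ t in t₁..t₂, gF t r θ) +
        (∫ θ in (0 : ℝ)..π, ∫ r in r₁..r₂, ∫ t in t₁..t₂, gΘ t r θ) -
        ∫ θ in (0 : ℝ)..π, ∫ r in r₁..r₂, ∫ t in t₁..t₂, gb t r θ := by
    simp only [e1, e2]
    rw [intervalIntegral.integral_sub (cS3.intervalIntegrable _ _) ((cI_θ gb cgb).intervalIntegrable _ _),
      intervalIntegral.integral_add ((cI_θ gF cgF).intervalIntegrable _ _)
        ((cI_θ gΘ cgΘ).intervalIntegrable _ _)]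
  /- Term A: the radial flux -/
  have hA : (∫ θ in (0 : ℝ)..π, ∫ r in r₁..r₂, ∫ t in t₁..t₂, gF t r θ) =
      ∫ t in t₁..t₂, ∫ θ in (0 : ℝ)..π, (f (boxPoint φ₀ t r₂ θ) - f (boxPoint φ₀ t r₁ θ)) := by
    have s1 : ∀ θ, (∫ r in r₁..r₂, ∫ t in t₁..t₂, gF t r θ) = ∫ t in t₁..t₂, ∫ r in r₁..r₂, gF t r θ := by
      intro θ
      have h : Continuous (Function.uncurry fun r t ↦ gF t r θ) := cgF.comp (m_rt θ)
      exact swap_continuous h hr ht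
    have s1' : (∫ θ in (0 : ℝ)..π, ∫ r in r₁..r₂, ∫ t in t₁..t₂, gF t r θ) =
        ∫ θ in (0 : ℝ)..π, ∫ t in t₁..t₂, ∫ r in r₁..r₂, gF t r θ :=
      intervalIntegral.integral_congr fun θ _ ↦ s1 θ
    rw [s1']
    have hftc : ∀ t ∈ Icc t₁ t₂, ∀ θ ∈ Icc (0 : ℝ) π,
        (∫ r in r₁..r₂, gF t r θ) = fF t r₂ θ - fF t r₁ θ := by
      intro t ht'' θ hθ
      have hderiv : ∀ r ∈ uIcc r₁ r₂, HasDerivAt (fun r' ↦ f (boxPoint φ₀ t r' θ)) (gF t r θ) r := by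
        intro r hr'
        rw [uIcc_of_le hr] at hr'
        have hq := hbox t ht'' r hr' θ hθ
        have h := hasDerivAt_comp_boxPoint_r (df _ hq)
        simp only [hgF, ct_eq t ht'', cr_eq r hr', cθ_eq θ hθ]
        exact h
      have hcont : Continuous fun r ↦ gF t r θ := cgF.comp (m_r t θ)
      rw [intervalIntegral.integral_eq_sub_of_hasDerivAt hderiv (hcont.intervalIntegrable _ _)]
      simp only [hfF, ct_eq t ht'', cr_eq r₂ hr₂, cr_eq r₁ hr₁, cθ_eq θ hθ]
    have hbdry : Continuous fun p : ℝ × ℝ ↦ fF p.2 r₂ p.1 - fF p.2 r₁ p.1 :=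
      (cfF.comp (Continuous.prodMk continuous_snd (Continuous.prodMk continuous_const continuous_fst))).sub
        (cfF.comp (Continuous.prodMk continuous_snd (Continuous.prodMk continuous_const continuous_fst)))
    have s2 : (∫ θ in (0 : ℝ)..π, ∫ t in t₁..t₂, ∫ r in r₁..r₂, gF t r θ) =
        ∫ θ in (0 : ℝ)..π, ∫ t in t₁..t₂, (fF t r₂ θ - fF t r₁ θ) := by
      refine intervalIntegral.integral_congr fun θ hθ ↦ ?_
      rw [uIcc_of_le hπ] at hθ
      refine intervalIntegral.integral_congr fun t ht' ↦ ?_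
      rw [uIcc_of_le ht] at ht'
      exact hftc t ht' θ hθ
    rw [s2]
    have s3 : (∫ θ in (0 : ℝ)..π, ∫ t in t₁..t₂, (fF t r₂ θ - fF t r₁ θ)) =
        ∫ t in t₁..t₂, ∫ θ in (0 : ℝ)..π, (fF t r₂ θ - fF t r₁ θ) := by
      have h : Continuous (Function.uncurry fun θ t ↦ fF t r₂ θ - fF t r₁ θ) := hbdry
      exact swap_continuous h hπ ht
    rw [s3]
    refine intervalIntegral.integral_congr fun t ht' ↦ ?_
    rw [uIcc_of_le ht] at ht'
    refine intervalIntegral.integral_congr fun θ hθ ↦ ?_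
    rw [uIcc_of_le hπ] at hθ
    simp only [hfF, ct_eq t ht', cr_eq r₂ hr₂, cr_eq r₁ hr₁, cθ_eq θ hθ]
  /- Term B: the polar flux -/
  have hB : (∫ θ in (0 : ℝ)..π, ∫ r in r₁..r₂, ∫ t in t₁..t₂, gΘ t r θ) =
      ∫ t in t₁..t₂, ∫ r in r₁..r₂, (g (boxPoint φ₀ t r π) - g (boxPoint φ₀ t r 0)) := by
    have s1 : (∫ θ in (0 : ℝ)..π, ∫ r in r₁..r₂, ∫ t in t₁..t₂, gΘ t r θ) =
        ∫ r in r₁..r₂, ∫ θ in (0 : ℝ)..π, ∫ t in t₁..t₂, gΘ t r θ := by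
      have h : Continuous (Function.uncurry fun θ r ↦ ∫ t in t₁..t₂, gΘ t r θ) :=
        (cI_rθ gΘ cgΘ).comp (Continuous.prodMk continuous_snd continuous_fst)
      exact swap_continuous h hπ hr
    rw [s1]
    have s2 : ∀ r, (∫ θ in (0 : ℝ)..π, ∫ t in t₁..t₂, gΘ t r θ) = ∫ t in t₁..t₂, ∫ θ in (0 : ℝ)..π, gΘ t r θ := by
      intro r
      have h : Continuous (Function.uncurry fun θ t ↦ gΘ t r θ) := cgΘ.comp (m_θt r)
      exact swap_continuous h hπ ht
    have s2' : (∫ r in r₁..r₂, ∫ θ in (0 : ℝ)..π, ∫ t in t₁..t₂, gΘ t r θ) =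
        ∫ r in r₁..r₂, ∫ t in t₁..t₂, ∫ θ in (0 : ℝ)..π, gΘ t r θ :=
      intervalIntegral.integral_congr fun r _ ↦ s2 r
    rw [s2']
    have hftc : ∀ t ∈ Icc t₁ t₂, ∀ r ∈ Icc r₁ r₂,
        (∫ θ in (0 : ℝ)..π, gΘ t r θ) = fG t r π - fG t r 0 := by
      intro t ht'' r hr''
      have hderiv : ∀ θ ∈ uIcc (0 : ℝ) π, HasDerivAt (fun θ' ↦ g (boxPoint φ₀ t r θ')) (gΘ t r θ) θ := by
        intro θ hθ
        rw [uIcc_of_le hπ] at hθ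
        have hq := hbox t ht'' r hr'' θ hθ
        have h := hasDerivAt_comp_boxPoint_theta (dg _ hq)
        simp only [hgΘ, ct_eq t ht'', cr_eq r hr'', cθ_eq θ hθ]
        exact h
      have hcont : Continuous fun θ ↦ gΘ t r θ := cgΘ.comp (m_θ t r)
      rw [intervalIntegral.integral_eq_sub_of_hasDerivAt hderiv (hcont.intervalIntegrable _ _)]
      simp only [hfG, ct_eq t ht'', cr_eq r hr'', cθ_eq π hππ, cθ_eq 0 h0π]
    have hbdry : Continuous fun p : ℝ × ℝ ↦ fG p.2 p.1 π - fG p.2 p.1 0 :=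
      (cfG.comp (Continuous.prodMk continuous_snd (Continuous.prodMk continuous_fst continuous_const))).sub
        (cfG.comp (Continuous.prodMk continuous_snd (Continuous.prodMk continuous_fst continuous_const)))
    have s3 : (∫ r in r₁..r₂, ∫ t in t₁..t₂, ∫ θ in (0 : ℝ)..π, gΘ t r θ) =
        ∫ r in r₁..r₂, ∫ t in t₁..t₂, (fG t r π - fG t r 0) := by
      refine intervalIntegral.integral_congr fun r hr'' ↦ ?_
      rw [uIcc_of_le hr] at hr''
      refine intervalIntegral.integral_congr fun t ht' ↦ ?_
      rw [uIcc_of_le ht] at ht'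
      exact hftc t ht' r hr''
    rw [s3]
    have s4 : (∫ r in r₁..r₂, ∫ t in t₁..t₂, (fG t r π - fG t r 0)) =
        ∫ t in t₁..t₂, ∫ r in r₁..r₂, (fG t r π - fG t r 0) := by
      have h : Continuous (Function.uncurry fun r t ↦ fG t r π - fG t r 0) := hbdry
      exact swap_continuous h hr ht
    rw [s4]
    refine intervalIntegral.integral_congr fun t ht' ↦ ?_
    rw [uIcc_of_le ht] at ht'
    refine intervalIntegral.integral_congr fun r hr'' ↦ ?_
    rw [uIcc_of_le hr] at hr''
    simp only [hfG, ct_eq t ht', cr_eq r hr'', cθ_eq π hππ, cθ_eq 0 h0π]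
  /- Term C: the bulk -/
  have hC : (∫ θ in (0 : ℝ)..π, ∫ r in r₁..r₂, ∫ t in t₁..t₂, gb t r θ) =
      ∫ t in t₁..t₂, ∫ θ in (0 : ℝ)..π, ∫ r in r₁..r₂, b (boxPoint φ₀ t r θ) := by
    have s1 : ∀ θ, (∫ r in r₁..r₂, ∫ t in t₁..t₂, gb t r θ) = ∫ t in t₁..t₂, ∫ r in r₁..r₂, gb t r θ := by
      intro θ
      have h : Continuous (Function.uncurry fun r t ↦ gb t r θ) := cgb.comp (m_rt θ)
      exact swap_continuous h hr ht
    have s1' : (∫ θ in (0 : ℝ)..π, ∫ r in r₁..r₂, ∫ t in t₁..t₂, gb t r θ) =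
        ∫ θ in (0 : ℝ)..π, ∫ t in t₁..t₂, ∫ r in r₁..r₂, gb t r θ :=
      intervalIntegral.integral_congr fun θ _ ↦ s1 θ
    rw [s1']
    have hItr : Continuous fun p : ℝ × ℝ ↦ ∫ r in r₁..r₂, gb p.1 r p.2 := by
      have m' : Continuous fun q : (ℝ × ℝ) × ℝ ↦ ((q.1.1, q.2, q.1.2) : ℝ × ℝ × ℝ) :=
        Continuous.prodMk (continuous_fst.comp continuous_fst) (Continuous.prodMk continuous_snd
          (continuous_snd.comp continuous_fst))
      have h : Continuous (Function.uncurry fun (p : ℝ × ℝ) r ↦ gb p.1 r p.2) := cgb.comp m'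
      exact intervalIntegral.continuous_parametric_intervalIntegral_of_continuous' h r₁ r₂
    have s2 : (∫ θ in (0 : ℝ)..π, ∫ t in t₁..t₂, ∫ r in r₁..r₂, gb t r θ) =
        ∫ t in t₁..t₂, ∫ θ in (0 : ℝ)..π, ∫ r in r₁..r₂, gb t r θ := by
      have h : Continuous (Function.uncurry fun θ t ↦ ∫ r in r₁..r₂, gb t r θ) :=
        hItr.comp (Continuous.prodMk continuous_snd continuous_fst)
      exact swap_continuous h hπ ht
    rw [s2]
    refine intervalIntegral.integral_congr fun t ht' ↦ ?_
    rw [uIcc_of_le ht] at ht'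
    refine intervalIntegral.integral_congr fun θ hθ ↦ ?_
    rw [uIcc_of_le hπ] at hθ
    refine intervalIntegral.integral_congr fun r hr'' ↦ ?_
    rw [uIcc_of_le hr] at hr''
    simp only [hgb, ct_eq t ht', cr_eq r hr'', cθ_eq θ hθ]
  rw [hlhs, hsplit, hA, hB, hC]
  ring

end BoxDivergence

/-! ### The radial multiplier `f(r) ∂_r`: pointwise identity -/

section RadialMultiplier

variable (M a : ℝ)

/-- The `t*`-density of the current of the radial multiplier `X = f(r)∂_r` (times `sin θ`):
`e_f = sin θ · f · (2Mr (∂_rG)² − (ρ² + 2Mr) ∂_rG ∂_{t*}G)`. [cite: Aretakis2012, §8] -/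
def radMultDensity (f : ℝ → ℝ) (G : E4 → ℝ) : E4 → ℝ := fun q ↦
  sin (q 2) * f (q 1) * (2 * M * q 1 * pd 1 G q ^ 2 -
    (q 1 ^ 2 + a ^ 2 * cos (q 2) ^ 2 + 2 * M * q 1) * pd 1 G q * pd 0 G q)

/-- The radial flux of the current of `X = f(r)∂_r` (times `sin θ`):
`f_f = ½ sin θ · f · (Δ (∂_rG)² + (ρ² + 2Mr)(∂_{t*}G)² − (∂_θG)²)`. [cite: Aretakis2012, §8] -/
def radMultFluxR (f : ℝ → ℝ) (G : E4 → ℝ) : E4 → ℝ := fun q ↦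
  1 / 2 * sin (q 2) * f (q 1) * ((q 1 ^ 2 - 2 * M * q 1 + a ^ 2) * pd 1 G q ^ 2 +
    (q 1 ^ 2 + a ^ 2 * cos (q 2) ^ 2 + 2 * M * q 1) * pd 0 G q ^ 2 - pd 2 G q ^ 2)

/-- The polar flux of the current of `X = f(r)∂_r`: `sin θ · f · ∂_rG ∂_θG`. [cite: Aretakis2012, §8] -/
def radMultFluxTheta (f : ℝ → ℝ) (G : E4 → ℝ) : E4 → ℝ := fun q ↦
  sin (q 2) * f (q 1) * pd 1 G q * pd 2 G q

/-- The bulk term of the radial multiplier `X = f(r)∂_r` (times `sin θ`), `f' = fr`: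
`½ sin θ [(fΔ' − f'Δ)(∂_rG)² + 4M f ∂_{t*}G ∂_rG − (f'(ρ² + 2Mr) + f(2r + 2M))(∂_{t*}G)² + f'(∂_θG)²]`.
[cite: Aretakis2012, §8] -/
def radMultBulk (f fr : ℝ → ℝ) (G : E4 → ℝ) : E4 → ℝ := fun q ↦
  1 / 2 * sin (q 2) * ((f (q 1) * (2 * q 1 - 2 * M) - fr (q 1) * (q 1 ^ 2 - 2 * M * q 1 + a ^ 2)) *
      pd 1 G q ^ 2 +
    4 * M * f (q 1) * pd 0 G q * pd 1 G q -
    (fr (q 1) * (q 1 ^ 2 + a ^ 2 * cos (q 2) ^ 2 + 2 * M * q 1) + f (q 1) * (2 * q 1 + 2 * M)) *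
      pd 0 G q ^ 2 +
    fr (q 1) * pd 2 G q ^ 2)

variable {M a} {W : Set E4} (hW : IsOpen W) (hWs : ∀ q ∈ W, sin (q 2) ≠ 0)
include hW hWs

/-- **The radial multiplier identity (pointwise).** For `G` smooth on an open `W ⊆ {sin θ ≠ 0}` and
`f` differentiable with derivative `fr`:
`sin θ · f(r) ∂_rG · (𝓡G + 𝓐G) = ∂_{t*} e_f + ∂_r f_f + ∂_θ(sin θ f ∂_rG ∂_θG) + bulk_f` on `W` — the
divergence identity `∇^μ(T_{μν}X^ν) = (□_g ψ) Xψ + ½ T^{μν}π^X_{μν}` for `X = f(r)∂_r` written in the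
coordinates `(t*, r, θ, φ*)` on axisymmetric functions (Aretakis 2012, §8, the currents
`J^{X}` with `X = f(r*)∂_{r*}`; Dafermos–Rodnianski arXiv:0811.0354, App. D). Proof: product rule
and symmetry of mixed partials. [cite: Aretakis2012, §8] -/
theorem radMult_identity {f fr : ℝ → ℝ} (hf : ∀ r, HasDerivAt f (fr r) r) {G : E4 → ℝ}
    (hG : ContDiffOn ℝ ∞ G W) :
    EqOn (fun q ↦ sin (q 2) * f (q 1) * pd 1 G q * (radOp M a G q + angOp a G q))
      (fun q ↦ pd 0 (radMultDensity M a f G) q + pd 1 (radMultFluxR M a f G) q +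
        pd 2 (radMultFluxTheta f G) q + radMultBulk M a f fr G q) W := by
  intro q hq
  have h0 := contDiffOn_pd hW hG 0
  have h1 := contDiffOn_pd hW hG 1
  have h2 := contDiffOn_pd hW hG 2
  -- derivatives of the coefficient functions
  have dΔ : HasFDerivAt (fun q : E4 ↦ q 1 ^ 2 - 2 * M * q 1 + a ^ 2)
      ((2 * q 1 - 2 * M) • PiLp.proj (𝕜 := ℝ) 2 (fun _ : Fin 4 ↦ ℝ) 1) q := by
    refine hasFDerivAt_coefFun (f := fun r ↦ r ^ 2 - 2 * M * r + a ^ 2) ?_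
    have h := (((hasDerivAt_id' (q 1)).pow 2).sub ((hasDerivAt_id' (q 1)).const_mul (2 * M))).add_const
      (a ^ 2)
    exact h.congr_deriv (by norm_num)
  have dMr : HasFDerivAt (fun q : E4 ↦ 2 * M * q 1)
      ((2 * M) • PiLp.proj (𝕜 := ℝ) 2 (fun _ : Fin 4 ↦ ℝ) 1) q := by
    refine hasFDerivAt_coefFun (f := fun r ↦ 2 * M * r) ?_
    exact ((hasDerivAt_id' (q 1)).const_mul (2 * M)).congr_deriv (by norm_num)
  have dSig : HasFDerivAt (fun q : E4 ↦ q 1 ^ 2 + a ^ 2 * cos (q 2) ^ 2 + 2 * M * q 1)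
      ((2 * q 1 + 2 * M) • PiLp.proj (𝕜 := ℝ) 2 (fun _ : Fin 4 ↦ ℝ) 1 +
        (a ^ 2 * (2 * cos (q 2) * -sin (q 2))) • PiLp.proj (𝕜 := ℝ) 2 (fun _ : Fin 4 ↦ ℝ) 2) q := by
    have hA : HasFDerivAt (fun q : E4 ↦ q 1 ^ 2 + 2 * M * q 1)
        ((2 * q 1 + 2 * M) • PiLp.proj (𝕜 := ℝ) 2 (fun _ : Fin 4 ↦ ℝ) 1) q := by
      refine hasFDerivAt_coefFun (f := fun r ↦ r ^ 2 + 2 * M * r) ?_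
      exact (((hasDerivAt_id' (q 1)).pow 2).add ((hasDerivAt_id' (q 1)).const_mul (2 * M))).congr_deriv
        (by norm_num)
    have hB : HasFDerivAt (fun q : E4 ↦ a ^ 2 * cos (q 2) ^ 2)
        ((a ^ 2 * (2 * cos (q 2) * -sin (q 2))) • PiLp.proj (𝕜 := ℝ) 2 (fun _ : Fin 4 ↦ ℝ) 2) q := by
      refine hasFDerivAt_coefFun (f := fun θ ↦ a ^ 2 * cos θ ^ 2) ?_
      exact (((hasDerivAt_cos (q 2)).pow 2).const_mul (a ^ 2)).congr_deriv (by norm_num)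
    have h := hA.add hB
    have hfun : (fun q : E4 ↦ q 1 ^ 2 + a ^ 2 * cos (q 2) ^ 2 + 2 * M * q 1) =
        fun q : E4 ↦ (q 1 ^ 2 + 2 * M * q 1) + a ^ 2 * cos (q 2) ^ 2 := by
      funext q; ring
    rw [hfun]
    exact h
  have dsin : HasFDerivAt (fun q : E4 ↦ sin (q 2))
      ((cos (q 2)) • PiLp.proj (𝕜 := ℝ) 2 (fun _ : Fin 4 ↦ ℝ) 2) q :=
    hasFDerivAt_coefFun (f := fun θ ↦ sin θ) (hasDerivAt_sin (q 2))
  have dfr : HasFDerivAt (fun q : E4 ↦ f (q 1)) ((fr (q 1)) • PiLp.proj (𝕜 := ℝ) 2 (fun _ : Fin 4 ↦ ℝ) 1) q :=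
    hasFDerivAt_coefFun (f := f) (hf (q 1))
  -- `sin θ · f(r)` and `½ sin θ · f(r)`
  have dsf : HasFDerivAt (fun q : E4 ↦ sin (q 2) * f (q 1)) _ q := dsin.mul dfr
  have dhsf : HasFDerivAt (fun q : E4 ↦ 1 / 2 * sin (q 2) * f (q 1)) _ q := (dsin.const_mul (1 / 2)).mul dfr
  -- the derivatives of `G`'s partials at `q`
  have D0 := hasFDerivAt_of_contDiffOn hW h0 hq
  have D1 := hasFDerivAt_of_contDiffOn hW h1 hq
  have D2 := hasFDerivAt_of_contDiffOn hW h2 hq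
  -- the three densities
  have hE : HasFDerivAt (radMultDensity M a f G) _ q :=
    dsf.mul ((dMr.mul (D1.pow 2)).sub ((dSig.mul D1).mul D0))
  have hF : HasFDerivAt (radMultFluxR M a f G) _ q :=
    dhsf.mul (((dΔ.mul (D1.pow 2)).add (dSig.mul (D0.pow 2))).sub (D2.pow 2))
  have hΘ : HasFDerivAt (radMultFluxTheta f G) _ q := (dsf.mul D1).mul D2
  -- evaluation of the coordinate projections on the basis vectors
  have p11 : (PiLp.proj (𝕜 := ℝ) 2 (fun _ : Fin 4 ↦ ℝ) 1) (E4.basisVector 1) = 1 := by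
    rw [proj_basisVector, if_pos rfl]
  have p22 : (PiLp.proj (𝕜 := ℝ) 2 (fun _ : Fin 4 ↦ ℝ) 2) (E4.basisVector 2) = 1 := by
    rw [proj_basisVector, if_pos rfl]
  have p12 : (PiLp.proj (𝕜 := ℝ) 2 (fun _ : Fin 4 ↦ ℝ) 2) (E4.basisVector 1) = 0 := by
    rw [proj_basisVector, if_neg (by decide)]
  have p21 : (PiLp.proj (𝕜 := ℝ) 2 (fun _ : Fin 4 ↦ ℝ) 1) (E4.basisVector 2) = 0 := by
    rw [proj_basisVector, if_neg (by decide)]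
  have p01 : (PiLp.proj (𝕜 := ℝ) 2 (fun _ : Fin 4 ↦ ℝ) 1) (E4.basisVector 0) = 0 := by
    rw [proj_basisVector, if_neg (by decide)]
  have p02 : (PiLp.proj (𝕜 := ℝ) 2 (fun _ : Fin 4 ↦ ℝ) 2) (E4.basisVector 0) = 0 := by
    rw [proj_basisVector, if_neg (by decide)]
  beta_reduce
  rw [pd_apply (G := radMultDensity M a f G), hE.fderiv, pd_apply (G := radMultFluxR M a f G), hF.fderiv,
    pd_apply (G := radMultFluxTheta f G), hΘ.fderiv]
  simp only [FunLike.coe_add, FunLike.coe_sub, Pi.add_apply, Pi.sub_apply, FunLike.coe_smul,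
    Pi.smul_apply, smul_eq_mul, nsmul_eq_mul, Pi.mul_apply, p11, p22, p12, p21, p01, p02,
    Nat.cast_ofNat, Nat.add_one_sub_one, pow_one, mul_one, mul_zero, add_zero, zero_add]
  simp only [← pd_apply]
  rw [pd_comm hW hG 0 1 hq, pd_comm hW hG 2 1 hq]
  have hs := hWs q hq
  have hsc := sin_sq_add_cos_sq (q 2)
  simp only [radOp, angOp, radMultBulk]
  field_simp
  linear_combination (2 * f (q 1) * pd 1 G q * sin (q 2) * a ^ 2 * pd 0 (pd 0 G) q) * hsc

end RadialMultiplier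

/-! ### The time multiplier `h(r) ∂_{t*}`: pointwise identity (from the `T`-energy identity) -/

section TimeMultiplier

variable (M a : ℝ)

/-- The `t*`-density of the current of `h(r)∂_{t*}`: `h e_T`. [cite: Aretakis2012, §8] -/
def timeMultDensity (h : ℝ → ℝ) (G : E4 → ℝ) : E4 → ℝ := fun q ↦ h (q 1) * tEnergy M a G q

/-- The radial flux of the current of `h(r)∂_{t*}`: `h f_T`. [cite: Aretakis2012, §8] -/
def timeMultFluxR (h : ℝ → ℝ) (G : E4 → ℝ) : E4 → ℝ := fun q ↦ h (q 1) * tFluxR M a G q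

/-- The polar flux of the current of `h(r)∂_{t*}`: `h sin θ ∂_θG ∂_{t*}G`. [cite: Aretakis2012, §8] -/
def timeMultFluxTheta (h : ℝ → ℝ) (G : E4 → ℝ) : E4 → ℝ := fun q ↦ h (q 1) * tFluxTheta G q

variable {M a} {W : Set E4} (hW : IsOpen W) (hWs : ∀ q ∈ W, sin (q 2) ≠ 0)
include hW hWs

/-- **The time multiplier identity (pointwise).** For `G` smooth on an open `W ⊆ {sin θ ≠ 0}` and
`h` differentiable with derivative `hr`:
`sin θ · h(r) ∂_{t*}G · (𝓡G + 𝓐G) = ∂_r(h f_T) + ∂_θ(h sin θ ∂_θG ∂_{t*}G) − ∂_{t*}(h e_T) − h'(r) f_T`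
on `W`: the current of `h(r)T` is `h J^T`, with bulk `−h' f_T = −T(∇h, ·)`-type term
(`tEnergy_identity` and the product rule). [cite: Aretakis2012, §8] -/
theorem timeMult_identity {h hr : ℝ → ℝ} (hh : ∀ r, HasDerivAt h (hr r) r) {G : E4 → ℝ}
    (hG : ContDiffOn ℝ ∞ G W) :
    EqOn (fun q ↦ sin (q 2) * h (q 1) * pd 0 G q * (radOp M a G q + angOp a G q))
      (fun q ↦ pd 1 (timeMultFluxR M a h G) q + pd 2 (timeMultFluxTheta h G) q -
        pd 0 (timeMultDensity M a h G) q - hr (q 1) * tFluxR M a G q) W := by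
  intro q hq
  obtain ⟨hE, hF, hΘ⟩ := contDiffOn_tEnergy_tFlux (M := M) (a := a) hW hG
  have hid := tEnergy_identity (M := M) (a := a) hW hWs hG hq
  -- the coefficient `h(r)` and its derivative
  have dh : HasFDerivAt (fun q : E4 ↦ h (q 1)) ((hr (q 1)) • PiLp.proj (𝕜 := ℝ) 2 (fun _ : Fin 4 ↦ ℝ) 1) q :=
    hasFDerivAt_coefFun (f := h) (hh (q 1))
  have DE := hasFDerivAt_of_contDiffOn hW hE hq
  have DF := hasFDerivAt_of_contDiffOn hW hF hq
  have DΘ := hasFDerivAt_of_contDiffOn hW hΘ hq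
  have h1 : HasFDerivAt (timeMultFluxR M a h G) _ q := dh.mul DF
  have h2 : HasFDerivAt (timeMultFluxTheta h G) _ q := dh.mul DΘ
  have h3 : HasFDerivAt (timeMultDensity M a h G) _ q := dh.mul DE
  have p11 : (PiLp.proj (𝕜 := ℝ) 2 (fun _ : Fin 4 ↦ ℝ) 1) (E4.basisVector 1) = 1 := by
    rw [proj_basisVector, if_pos rfl]
  have p21 : (PiLp.proj (𝕜 := ℝ) 2 (fun _ : Fin 4 ↦ ℝ) 1) (E4.basisVector 2) = 0 := by
    rw [proj_basisVector, if_neg (by decide)]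
  have p01 : (PiLp.proj (𝕜 := ℝ) 2 (fun _ : Fin 4 ↦ ℝ) 1) (E4.basisVector 0) = 0 := by
    rw [proj_basisVector, if_neg (by decide)]
  beta_reduce
  rw [pd_apply (G := timeMultFluxR M a h G), h1.fderiv, pd_apply (G := timeMultFluxTheta h G), h2.fderiv,
    pd_apply (G := timeMultDensity M a h G), h3.fderiv]
  simp only [FunLike.coe_add, Pi.add_apply, FunLike.coe_smul, Pi.smul_apply, smul_eq_mul, p11, p21, p01,
    mul_one, mul_zero, add_zero]
  simp only [← pd_apply]
  simp only at hid
  linear_combination h (q 1) * hid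

end TimeMultiplier

/-! ### The Lagrangian (zeroth-order) term `w(r) G`: pointwise identity -/

section Lagrangian

variable (M a : ℝ)

/-- The `t*`-density of the modified current of the zeroth-order multiplier `w(r)`:
`sin θ · w · (4Mr G ∂_rG + M G² − (ρ² + 2Mr) G ∂_{t*}G)`. [cite: Aretakis2012, §8] -/
def lagDensity (w : ℝ → ℝ) (G : E4 → ℝ) : E4 → ℝ := fun q ↦
  sin (q 2) * w (q 1) * (4 * M * q 1 * G q * pd 1 G q + M * G q ^ 2 -
    (q 1 ^ 2 + a ^ 2 * cos (q 2) ^ 2 + 2 * M * q 1) * G q * pd 0 G q)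

/-- The radial flux of the modified current of `w(r)`: `sin θ (w Δ G ∂_rG − ½ w' Δ G²)`.
[cite: Aretakis2012, §8] -/
def lagFluxR (w wr : ℝ → ℝ) (G : E4 → ℝ) : E4 → ℝ := fun q ↦
  sin (q 2) * (w (q 1) * (q 1 ^ 2 - 2 * M * q 1 + a ^ 2) * G q * pd 1 G q -
    1 / 2 * wr (q 1) * (q 1 ^ 2 - 2 * M * q 1 + a ^ 2) * G q ^ 2)

/-- The polar flux of the modified current of `w(r)`: `sin θ · w · G ∂_θG`. [cite: Aretakis2012, §8] -/
def lagFluxTheta (w : ℝ → ℝ) (G : E4 → ℝ) : E4 → ℝ := fun q ↦ sin (q 2) * w (q 1) * G q * pd 2 G q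

/-- The bulk of the zeroth-order multiplier `w(r)` (`w' = wr`, `w'' = wrr`):
`sin θ [−wΔ(∂_rG)² + ½ (w''Δ + w'Δ') G² − 4Mr w ∂_{t*}G ∂_rG + (ρ² + 2Mr) w (∂_{t*}G)² − w(∂_θG)²]`.
[cite: Aretakis2012, §8] -/
def lagBulk (w wr wrr : ℝ → ℝ) (G : E4 → ℝ) : E4 → ℝ := fun q ↦
  sin (q 2) * (-(w (q 1) * (q 1 ^ 2 - 2 * M * q 1 + a ^ 2) * pd 1 G q ^ 2) +
    1 / 2 * (wrr (q 1) * (q 1 ^ 2 - 2 * M * q 1 + a ^ 2) + wr (q 1) * (2 * q 1 - 2 * M)) * G q ^ 2 -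
    4 * M * q 1 * w (q 1) * pd 0 G q * pd 1 G q +
    (q 1 ^ 2 + a ^ 2 * cos (q 2) ^ 2 + 2 * M * q 1) * w (q 1) * pd 0 G q ^ 2 -
    w (q 1) * pd 2 G q ^ 2)

variable {M a} {W : Set E4} (hW : IsOpen W) (hWs : ∀ q ∈ W, sin (q 2) ≠ 0)
include hW hWs

/-- **The Lagrangian multiplier identity (pointwise).** For `G` smooth on an open `W ⊆ {sin θ ≠ 0}`
and `w` twice differentiable (`w' = wr`, `w'' = wrr`):
`sin θ · w(r) G · (𝓡G + 𝓐G) = ∂_{t*} e_w + ∂_r f_w + ∂_θ(sin θ w G ∂_θG) + bulk_w` on `W` — the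
zeroth-order ("Lagrangian") modification of multiplier currents, `J^{X,w}_μ = J^X_μ + w ψ ∂_μψ − ½ (∂_μ w) ψ²`
in the coordinates `(t*, r, θ, φ*)` (Aretakis 2012, §8; Dafermos–Rodnianski arXiv:0811.0354, App. D).
[cite: Aretakis2012, §8] -/
theorem lag_identity {w wr wrr : ℝ → ℝ} (hw : ∀ r, HasDerivAt w (wr r) r)
    (hwr : ∀ r, HasDerivAt wr (wrr r) r) {G : E4 → ℝ} (hG : ContDiffOn ℝ ∞ G W) :
    EqOn (fun q ↦ sin (q 2) * w (q 1) * G q * (radOp M a G q + angOp a G q))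
      (fun q ↦ pd 0 (lagDensity M a w G) q + pd 1 (lagFluxR M a w wr G) q +
        pd 2 (lagFluxTheta w G) q + lagBulk M a w wr wrr G q) W := by
  intro q hq
  have h0 := contDiffOn_pd hW hG 0
  have h1 := contDiffOn_pd hW hG 1
  have h2 := contDiffOn_pd hW hG 2
  -- derivatives of the coefficient functions
  have dΔ : HasFDerivAt (fun q : E4 ↦ q 1 ^ 2 - 2 * M * q 1 + a ^ 2)
      ((2 * q 1 - 2 * M) • PiLp.proj (𝕜 := ℝ) 2 (fun _ : Fin 4 ↦ ℝ) 1) q := by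
    refine hasFDerivAt_coefFun (f := fun r ↦ r ^ 2 - 2 * M * r + a ^ 2) ?_
    have h := (((hasDerivAt_id' (q 1)).pow 2).sub ((hasDerivAt_id' (q 1)).const_mul (2 * M))).add_const
      (a ^ 2)
    exact h.congr_deriv (by norm_num)
  have d4Mr : HasFDerivAt (fun q : E4 ↦ 4 * M * q 1)
      ((4 * M) • PiLp.proj (𝕜 := ℝ) 2 (fun _ : Fin 4 ↦ ℝ) 1) q := by
    refine hasFDerivAt_coefFun (f := fun r ↦ 4 * M * r) ?_
    exact ((hasDerivAt_id' (q 1)).const_mul (4 * M)).congr_deriv (by norm_num)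
  have dSig : HasFDerivAt (fun q : E4 ↦ q 1 ^ 2 + a ^ 2 * cos (q 2) ^ 2 + 2 * M * q 1)
      ((2 * q 1 + 2 * M) • PiLp.proj (𝕜 := ℝ) 2 (fun _ : Fin 4 ↦ ℝ) 1 +
        (a ^ 2 * (2 * cos (q 2) * -sin (q 2))) • PiLp.proj (𝕜 := ℝ) 2 (fun _ : Fin 4 ↦ ℝ) 2) q := by
    have hA : HasFDerivAt (fun q : E4 ↦ q 1 ^ 2 + 2 * M * q 1)
        ((2 * q 1 + 2 * M) • PiLp.proj (𝕜 := ℝ) 2 (fun _ : Fin 4 ↦ ℝ) 1) q := by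
      refine hasFDerivAt_coefFun (f := fun r ↦ r ^ 2 + 2 * M * r) ?_
      exact (((hasDerivAt_id' (q 1)).pow 2).add ((hasDerivAt_id' (q 1)).const_mul (2 * M))).congr_deriv
        (by norm_num)
    have hB : HasFDerivAt (fun q : E4 ↦ a ^ 2 * cos (q 2) ^ 2)
        ((a ^ 2 * (2 * cos (q 2) * -sin (q 2))) • PiLp.proj (𝕜 := ℝ) 2 (fun _ : Fin 4 ↦ ℝ) 2) q := by
      refine hasFDerivAt_coefFun (f := fun θ ↦ a ^ 2 * cos θ ^ 2) ?_
      exact (((hasDerivAt_cos (q 2)).pow 2).const_mul (a ^ 2)).congr_deriv (by norm_num)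
    have h := hA.add hB
    have hfun : (fun q : E4 ↦ q 1 ^ 2 + a ^ 2 * cos (q 2) ^ 2 + 2 * M * q 1) =
        fun q : E4 ↦ (q 1 ^ 2 + 2 * M * q 1) + a ^ 2 * cos (q 2) ^ 2 := by
      funext q; ring
    rw [hfun]
    exact h
  have dsin : HasFDerivAt (fun q : E4 ↦ sin (q 2))
      ((cos (q 2)) • PiLp.proj (𝕜 := ℝ) 2 (fun _ : Fin 4 ↦ ℝ) 2) q :=
    hasFDerivAt_coefFun (f := fun θ ↦ sin θ) (hasDerivAt_sin (q 2))
  have dw : HasFDerivAt (fun q : E4 ↦ w (q 1)) ((wr (q 1)) • PiLp.proj (𝕜 := ℝ) 2 (fun _ : Fin 4 ↦ ℝ) 1) q :=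
    hasFDerivAt_coefFun (f := w) (hw (q 1))
  have dwr : HasFDerivAt (fun q : E4 ↦ 1 / 2 * wr (q 1))
      ((1 / 2 * wrr (q 1)) • PiLp.proj (𝕜 := ℝ) 2 (fun _ : Fin 4 ↦ ℝ) 1) q := by
    refine hasFDerivAt_coefFun (f := fun r ↦ 1 / 2 * wr r) ?_
    exact ((hwr (q 1)).const_mul (1 / 2)).congr_deriv (by ring)
  have dsw : HasFDerivAt (fun q : E4 ↦ sin (q 2) * w (q 1)) _ q := dsin.mul dw
  -- `G` and its partials at `q`
  have DG := hasFDerivAt_of_contDiffOn hW hG hq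
  have D0 := hasFDerivAt_of_contDiffOn hW h0 hq
  have D1 := hasFDerivAt_of_contDiffOn hW h1 hq
  have D2 := hasFDerivAt_of_contDiffOn hW h2 hq
  -- the three densities
  have hE : HasFDerivAt (lagDensity M a w G) _ q :=
    dsw.mul ((((d4Mr.mul DG).mul D1).add ((DG.pow 2).const_mul M)).sub ((dSig.mul DG).mul D0))
  have hF : HasFDerivAt (lagFluxR M a w wr G) _ q :=
    dsin.mul ((((dw.mul dΔ).mul DG).mul D1).sub ((dwr.mul dΔ).mul (DG.pow 2)))
  have hΘ : HasFDerivAt (lagFluxTheta w G) _ q := (dsw.mul DG).mul D2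
  -- evaluation of the coordinate projections on the basis vectors
  have p11 : (PiLp.proj (𝕜 := ℝ) 2 (fun _ : Fin 4 ↦ ℝ) 1) (E4.basisVector 1) = 1 := by
    rw [proj_basisVector, if_pos rfl]
  have p22 : (PiLp.proj (𝕜 := ℝ) 2 (fun _ : Fin 4 ↦ ℝ) 2) (E4.basisVector 2) = 1 := by
    rw [proj_basisVector, if_pos rfl]
  have p12 : (PiLp.proj (𝕜 := ℝ) 2 (fun _ : Fin 4 ↦ ℝ) 2) (E4.basisVector 1) = 0 := by
    rw [proj_basisVector, if_neg (by decide)]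
  have p21 : (PiLp.proj (𝕜 := ℝ) 2 (fun _ : Fin 4 ↦ ℝ) 1) (E4.basisVector 2) = 0 := by
    rw [proj_basisVector, if_neg (by decide)]
  have p01 : (PiLp.proj (𝕜 := ℝ) 2 (fun _ : Fin 4 ↦ ℝ) 1) (E4.basisVector 0) = 0 := by
    rw [proj_basisVector, if_neg (by decide)]
  have p02 : (PiLp.proj (𝕜 := ℝ) 2 (fun _ : Fin 4 ↦ ℝ) 2) (E4.basisVector 0) = 0 := by
    rw [proj_basisVector, if_neg (by decide)]
  beta_reduce
  rw [pd_apply (G := lagDensity M a w G), hE.fderiv, pd_apply (G := lagFluxR M a w wr G), hF.fderiv,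
    pd_apply (G := lagFluxTheta w G), hΘ.fderiv]
  simp only [FunLike.coe_add, FunLike.coe_sub, Pi.add_apply, Pi.sub_apply, FunLike.coe_smul,
    Pi.smul_apply, smul_eq_mul, nsmul_eq_mul, Pi.mul_apply, p11, p22, p12, p21, p01, p02,
    Nat.cast_ofNat, Nat.add_one_sub_one, pow_one, mul_one, mul_zero, add_zero, zero_add]
  simp only [← pd_apply]
  rw [pd_comm hW hG 0 1 hq]
  have hs := hWs q hq
  have hsc := sin_sq_add_cos_sq (q 2)
  simp only [radOp, angOp, lagBulk]
  field_simp
  linear_combination (2 * w (q 1) * G q * sin (q 2) * a ^ 2 * pd 0 (pd 0 G) q) * hsc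

end Lagrangian

/-! ### Assembly: the `(f∂_r + h∂_{t*}, w)`-multiplier identity for solutions, across the axis and on boxes -/

section Assembly

variable (M a : ℝ)

/-- The total `t*`-density `e_{f,h,w} = e_f − h e_T + e_w` of the multiplier `X = f(r)∂_r + h(r)∂_{t*}`
with Lagrangian term `w(r)` (in the convention `0 = ∂_{t*}e + ∂_r F + ∂_θ Θ + bulk` for solutions).
[cite: Aretakis2012, §8] -/
def multDensity (f h w : ℝ → ℝ) (G : E4 → ℝ) : E4 → ℝ := fun q ↦
  radMultDensity M a f G q - timeMultDensity M a h G q + lagDensity M a w G q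

/-- The total radial flux `F_{f,h,w} = f_f + h f_T + f_w`. [cite: Aretakis2012, §8] -/
def multFluxR (f h w : ℝ → ℝ) (G : E4 → ℝ) : E4 → ℝ := fun q ↦
  radMultFluxR M a f G q + timeMultFluxR M a h G q + lagFluxR M a w (deriv w) G q

/-- The total polar flux (vanishing at the poles). [cite: Aretakis2012, §8] -/
def multFluxTheta (f h w : ℝ → ℝ) (G : E4 → ℝ) : E4 → ℝ := fun q ↦
  radMultFluxTheta f G q + timeMultFluxTheta h G q + lagFluxTheta w G q

/-- The total bulk `bulk_f − h' f_T + bulk_w`. [cite: Aretakis2012, §8] -/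
def multBulk (f h w : ℝ → ℝ) (G : E4 → ℝ) : E4 → ℝ := fun q ↦
  radMultBulk M a f (deriv f) G q - deriv h (q 1) * tFluxR M a G q +
    lagBulk M a w (deriv w) (deriv (deriv w)) G q

variable {M a}

/-- A coefficient `q ↦ c(q 1)` with `c` smooth is smooth on any set. [folklore] -/
theorem contDiffOn_radial {c : ℝ → ℝ} (hc : ContDiff ℝ ∞ c) (W : Set E4) :
    ContDiffOn ℝ ∞ (fun q : E4 ↦ c (q 1)) W := by
  have h1 : ContDiff ℝ ∞ (fun q : E4 ↦ q 1) := contDiff_coord 1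
  exact (hc.comp h1).contDiffOn

/-- **Smoothness of the densities** on an open set of smoothness of `G`, for smooth `f, h, w`.
[folklore] -/
theorem contDiffOn_mult {W : Set E4} (hW : IsOpen W) {G : E4 → ℝ} (hG : ContDiffOn ℝ ∞ G W)
    {f h w : ℝ → ℝ} (hf : ContDiff ℝ ∞ f) (hh : ContDiff ℝ ∞ h) (hw : ContDiff ℝ ∞ w) :
    ContDiffOn ℝ ∞ (multDensity M a f h w G) W ∧ ContDiffOn ℝ ∞ (multFluxR M a f h w G) W ∧
      ContDiffOn ℝ ∞ (multFluxTheta f h w G) W ∧ ContinuousOn (multBulk M a f h w G) W := by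
  obtain ⟨hE, hF, hΘ⟩ := contDiffOn_tEnergy_tFlux (M := M) (a := a) hW hG
  have h0 := contDiffOn_pd hW hG 0
  have h1 := contDiffOn_pd hW hG 1
  have h2 := contDiffOn_pd hW hG 2
  have hc : ∀ j : Fin 4, ContDiffOn ℝ ∞ (fun q : E4 ↦ q j) W := fun j ↦ (contDiff_coord j).contDiffOn
  have hsin : ContDiffOn ℝ ∞ (fun q : E4 ↦ sin (q 2)) W := contDiff_sin.comp_contDiffOn (hc 2)
  have hcos : ContDiffOn ℝ ∞ (fun q : E4 ↦ cos (q 2)) W := contDiff_cos.comp_contDiffOn (hc 2)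
  have hΔ : ContDiffOn ℝ ∞ (fun q : E4 ↦ q 1 ^ 2 - 2 * M * q 1 + a ^ 2) W :=
    (((hc 1).pow 2).sub (contDiffOn_const.mul (hc 1))).add contDiffOn_const
  have hSig : ContDiffOn ℝ ∞ (fun q : E4 ↦ q 1 ^ 2 + a ^ 2 * cos (q 2) ^ 2 + 2 * M * q 1) W :=
    (((hc 1).pow 2).add (contDiffOn_const.mul (hcos.pow 2))).add (contDiffOn_const.mul (hc 1))
  have cf := contDiffOn_radial hf W
  have cfr := contDiffOn_radial (contDiff_infty_iff_deriv.mp hf).2 W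
  have ch := contDiffOn_radial hh W
  have chr := contDiffOn_radial (contDiff_infty_iff_deriv.mp hh).2 W
  have cw := contDiffOn_radial hw W
  have hw' := (contDiff_infty_iff_deriv.mp hw).2
  have cwr := contDiffOn_radial hw' W
  have cwrr := contDiffOn_radial (contDiff_infty_iff_deriv.mp hw').2 W
  refine ⟨?_, ?_, ?_, ?_⟩
  · unfold multDensity radMultDensity timeMultDensity lagDensity
    refine (((hsin.mul cf).mul (((contDiffOn_const.mul (hc 1)).mul (h1.pow 2)).sub
      ((hSig.mul h1).mul h0))).sub (ch.mul hE)).add ?_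
    exact (hsin.mul cw).mul (((((contDiffOn_const.mul (hc 1)).mul hG).mul h1).add
      (contDiffOn_const.mul (hG.pow 2))).sub ((hSig.mul hG).mul h0))
  · unfold multFluxR radMultFluxR timeMultFluxR lagFluxR
    refine ((((contDiffOn_const.mul hsin).mul cf).mul (((hΔ.mul (h1.pow 2)).add
      (hSig.mul (h0.pow 2))).sub (h2.pow 2))).add (ch.mul hF)).add ?_
    exact hsin.mul ((((cw.mul hΔ).mul hG).mul h1).sub (((contDiffOn_const.mul cwr).mul hΔ).mul (hG.pow 2)))
  · unfold multFluxTheta radMultFluxTheta timeMultFluxTheta lagFluxTheta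
    exact ((((hsin.mul cf).mul h1).mul h2).add (ch.mul hΘ)).add (((hsin.mul cw).mul hG).mul h2)
  · have hsm : ContDiffOn ℝ ∞ (multBulk M a f h w G) W := by
      unfold multBulk radMultBulk lagBulk
      refine (((contDiffOn_const.mul hsin).mul ((((((cf.mul ((contDiffOn_const.mul (hc 1)).sub
        contDiffOn_const)).sub (cfr.mul hΔ)).mul (h1.pow 2)).add
        (((contDiffOn_const.mul cf).mul h0).mul h1)).sub
        (((cfr.mul hSig).add (cf.mul ((contDiffOn_const.mul (hc 1)).add contDiffOn_const))).mul
          (h0.pow 2))).add (cfr.mul (h2.pow 2)))).sub (chr.mul hF)).add ?_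
      exact hsin.mul ((((((cw.mul hΔ).mul (h1.pow 2)).neg).add ((contDiffOn_const.mul
        ((cwrr.mul hΔ).add (cwr.mul ((contDiffOn_const.mul (hc 1)).sub contDiffOn_const)))).mul
          (hG.pow 2))).sub ((((contDiffOn_const.mul (hc 1)).mul cw).mul h0).mul h1)).add
        ((hSig.mul cw).mul (h0.pow 2)) |>.sub (cw.mul (h2.pow 2)))
    exact hsm.continuousOn

/-- **A continuous function on an open set which vanishes off the axis vanishes everywhere**
(the axis `{sin θ = 0}` has empty interior; approach along `s ↦ q + s∂_θ`). [folklore] -/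
theorem eq_zero_of_eq_zero_offAxis {W₀ : Set E4} (hW₀ : IsOpen W₀) {D : E4 → ℝ}
    (hDc : ContinuousOn D W₀) (hD0 : ∀ q ∈ W₀, sin (q 2) ≠ 0 → D q = 0) : ∀ q ∈ W₀, D q = 0 := by
  intro q hq
  by_cases hs : sin (q 2) ≠ 0
  · exact hD0 q hq hs
  push Not at hs
  set γ : ℝ → E4 := fun s ↦ q + s • E4.basisVector 2 with hγ
  have hγc : Continuous γ := continuous_const.add (continuous_id.smul continuous_const)
  have hγ0 : γ 0 = q := by simp [hγ]
  have hev : ∀ᶠ s in 𝓝 (0 : ℝ), γ s ∈ W₀ :=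
    hγc.continuousAt.preimage_mem_nhds (by rw [hγ0]; exact hW₀.mem_nhds hq)
  have hcos : cos (q 2) ≠ 0 := by
    intro hc
    have := sin_sq_add_cos_sq (q 2)
    rw [hs, hc] at this
    norm_num at this
  have hsmall : ∀ᶠ s in 𝓝[≠] (0 : ℝ), sin s ≠ 0 := by
    have h1 : ∀ᶠ s in 𝓝 (0 : ℝ), s ∈ Ioo (-π) π := Ioo_mem_nhds (by linarith [pi_pos]) pi_pos
    filter_upwards [mem_nhdsWithin_of_mem_nhds h1, self_mem_nhdsWithin] with s hs1 hs0
    intro h0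
    rcases lt_or_gt_of_ne hs0 with hneg | hpos
    · have := sin_neg_of_neg_of_neg_pi_lt hneg hs1.1
      linarith
    · have := sin_pos_of_pos_of_lt_pi hpos hs1.2
      linarith
  have hev' : ∀ᶠ s in 𝓝[≠] (0 : ℝ), D (γ s) = 0 := by
    filter_upwards [mem_nhdsWithin_of_mem_nhds hev, hsmall] with s hsW₀ hss
    refine hD0 _ hsW₀ ?_
    show sin ((q + s • E4.basisVector 2) 2) ≠ 0
    rw [add_smul_basisVector_apply, if_pos rfl, sin_add, hs, zero_mul, zero_add]
    exact mul_ne_zero hcos hss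
  have htend : Tendsto (fun s ↦ D (γ s)) (𝓝[≠] 0) (𝓝 (D q)) := by
    have h1 : Tendsto γ (𝓝[≠] 0) (𝓝[W₀] q) := by
      refine tendsto_nhdsWithin_iff.2 ⟨?_, mem_nhdsWithin_of_mem_nhds hev⟩
      rw [← hγ0]
      exact hγc.continuousAt.tendsto.mono_left nhdsWithin_le_nhds
    exact (hDc _ hq).tendsto.comp h1
  have hconst : Tendsto (fun s ↦ D (γ s)) (𝓝[≠] 0) (𝓝 0) :=
    tendsto_const_nhds.congr' (hev'.mono fun s h ↦ h.symm)
  exact tendsto_nhds_unique htend hconst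

/-- **The multiplier identity for solutions, at every point** (off the axis by the three pointwise
identities and `𝓡G + 𝓐G = 0`; on the axis by continuity):
`∂_{t*} e_{f,h,w} + ∂_r F_{f,h,w} + ∂_θ Θ_{f,h,w} + bulk_{f,h,w} = 0` on `W₀`.
[cite: Aretakis2012, §8] -/
theorem mult_divergence_eq_zero {W₀ : Set E4} (hW₀ : IsOpen W₀) {G : E4 → ℝ}
    (hG : ContDiffOn ℝ ∞ G W₀) (hP : ∀ q ∈ W₀, sin (q 2) ≠ 0 → radOp M a G q + angOp a G q = 0)
    {f h w : ℝ → ℝ} (hf : ContDiff ℝ ∞ f) (hh : ContDiff ℝ ∞ h) (hw : ContDiff ℝ ∞ w) :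
    ∀ q ∈ W₀, pd 0 (multDensity M a f h w G) q + pd 1 (multFluxR M a f h w G) q +
      pd 2 (multFluxTheta f h w G) q + multBulk M a f h w G q = 0 := by
  -- the derivatives of the radial profiles
  have hf' : ∀ r, HasDerivAt f (deriv f r) r := fun r ↦
    ((contDiff_infty_iff_deriv.mp hf).1 r).hasDerivAt
  have hh' : ∀ r, HasDerivAt h (deriv h r) r := fun r ↦
    ((contDiff_infty_iff_deriv.mp hh).1 r).hasDerivAt
  have hw' : ∀ r, HasDerivAt w (deriv w r) r := fun r ↦
    ((contDiff_infty_iff_deriv.mp hw).1 r).hasDerivAt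
  have hw'' : ∀ r, HasDerivAt (deriv w) (deriv (deriv w) r) r := fun r ↦
    ((contDiff_infty_iff_deriv.mp (contDiff_infty_iff_deriv.mp hw).2).1 r).hasDerivAt
  obtain ⟨hE, hF, hΘ⟩ := contDiffOn_tEnergy_tFlux (M := M) (a := a) hW₀ hG
  obtain ⟨cD, cFl, cTh, cB⟩ := contDiffOn_mult (M := M) (a := a) hW₀ hG hf hh hw
  -- smoothness of the nine individual densities (for the additivity of `pd`)
  have h0 := contDiffOn_pd hW₀ hG 0
  have h1 := contDiffOn_pd hW₀ hG 1
  have h2 := contDiffOn_pd hW₀ hG 2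
  have hc : ∀ j : Fin 4, ContDiffOn ℝ ∞ (fun q : E4 ↦ q j) W₀ := fun j ↦ (contDiff_coord j).contDiffOn
  have hsin : ContDiffOn ℝ ∞ (fun q : E4 ↦ sin (q 2)) W₀ := contDiff_sin.comp_contDiffOn (hc 2)
  have hcos : ContDiffOn ℝ ∞ (fun q : E4 ↦ cos (q 2)) W₀ := contDiff_cos.comp_contDiffOn (hc 2)
  have hΔ : ContDiffOn ℝ ∞ (fun q : E4 ↦ q 1 ^ 2 - 2 * M * q 1 + a ^ 2) W₀ :=
    (((hc 1).pow 2).sub (contDiffOn_const.mul (hc 1))).add contDiffOn_const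
  have hSig : ContDiffOn ℝ ∞ (fun q : E4 ↦ q 1 ^ 2 + a ^ 2 * cos (q 2) ^ 2 + 2 * M * q 1) W₀ :=
    (((hc 1).pow 2).add (contDiffOn_const.mul (hcos.pow 2))).add (contDiffOn_const.mul (hc 1))
  have cf := contDiffOn_radial hf W₀
  have ch := contDiffOn_radial hh W₀
  have cw := contDiffOn_radial hw W₀
  have cwr := contDiffOn_radial (contDiff_infty_iff_deriv.mp hw).2 W₀
  have sRD : ContDiffOn ℝ ∞ (radMultDensity M a f G) W₀ := by
    unfold radMultDensity
    exact (hsin.mul cf).mul (((contDiffOn_const.mul (hc 1)).mul (h1.pow 2)).sub ((hSig.mul h1).mul h0))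
  have sTD : ContDiffOn ℝ ∞ (timeMultDensity M a h G) W₀ := by
    unfold timeMultDensity; exact ch.mul hE
  have sLD : ContDiffOn ℝ ∞ (lagDensity M a w G) W₀ := by
    unfold lagDensity
    exact (hsin.mul cw).mul (((((contDiffOn_const.mul (hc 1)).mul hG).mul h1).add
      (contDiffOn_const.mul (hG.pow 2))).sub ((hSig.mul hG).mul h0))
  have sRF : ContDiffOn ℝ ∞ (radMultFluxR M a f G) W₀ := by
    unfold radMultFluxR
    exact ((contDiffOn_const.mul hsin).mul cf).mul (((hΔ.mul (h1.pow 2)).add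
      (hSig.mul (h0.pow 2))).sub (h2.pow 2))
  have sTF : ContDiffOn ℝ ∞ (timeMultFluxR M a h G) W₀ := by
    unfold timeMultFluxR; exact ch.mul hF
  have sLF : ContDiffOn ℝ ∞ (lagFluxR M a w (deriv w) G) W₀ := by
    unfold lagFluxR
    exact hsin.mul ((((cw.mul hΔ).mul hG).mul h1).sub (((contDiffOn_const.mul cwr).mul hΔ).mul (hG.pow 2)))
  have sRT : ContDiffOn ℝ ∞ (radMultFluxTheta f G) W₀ := by
    unfold radMultFluxTheta; exact ((hsin.mul cf).mul h1).mul h2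
  have sTT : ContDiffOn ℝ ∞ (timeMultFluxTheta h G) W₀ := by
    unfold timeMultFluxTheta; exact ch.mul hΘ
  have sLT : ContDiffOn ℝ ∞ (lagFluxTheta w G) W₀ := by
    unfold lagFluxTheta; exact ((hsin.mul cw).mul hG).mul h2
  -- the defect and its continuity
  set D : E4 → ℝ := fun q ↦ pd 0 (multDensity M a f h w G) q + pd 1 (multFluxR M a f h w G) q +
    pd 2 (multFluxTheta f h w G) q + multBulk M a f h w G q with hDdef
  have hDc : ContinuousOn D W₀ :=
    ((((contDiffOn_pd hW₀ cD 0).continuousOn).add (contDiffOn_pd hW₀ cFl 1).continuousOn).add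
      (contDiffOn_pd hW₀ cTh 2).continuousOn).add cB
  -- off the axis
  set W : Set E4 := W₀ ∩ {q : E4 | sin (q 2) ≠ 0} with hWdef
  have hW : IsOpen W :=
    hW₀.inter (isOpen_ne_fun (continuous_sin.comp (PiLp.continuous_apply 2 _ 2)) continuous_const)
  have hWs : ∀ q ∈ W, sin (q 2) ≠ 0 := fun q hq ↦ hq.2
  have hGW : ContDiffOn ℝ ∞ G W := hG.mono inter_subset_left
  have hD0 : ∀ q ∈ W₀, sin (q 2) ≠ 0 → D q = 0 := by
    intro q hq hs
    have hqW : q ∈ W := ⟨hq, hs⟩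
    have iR := radMult_identity (M := M) (a := a) hW hWs hf' hGW hqW
    have iT := timeMult_identity (M := M) (a := a) hW hWs hh' hGW hqW
    have iL := lag_identity (M := M) (a := a) hW hWs hw' hw'' hGW hqW
    simp only [hP q hq hs, mul_zero] at iR iT iL
    -- additivity of the coordinate derivatives on `W₀`
    have e0 : pd 0 (multDensity M a f h w G) q =
        pd 0 (radMultDensity M a f G) q - pd 0 (timeMultDensity M a h G) q + pd 0 (lagDensity M a w G) q := by
      have hfun : multDensity M a f h w G = (radMultDensity M a f G - timeMultDensity M a h G) +
          lagDensity M a w G := rfl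
      rw [hfun, pd_add hW₀ (G₁ := radMultDensity M a f G - timeMultDensity M a h G)
        (G₂ := lagDensity M a w G) (sRD.sub sTD) sLD 0 hq, Pi.add_apply, pd_sub hW₀ sRD sTD 0 hq,
        Pi.sub_apply]
    have e1 : pd 1 (multFluxR M a f h w G) q =
        pd 1 (radMultFluxR M a f G) q + pd 1 (timeMultFluxR M a h G) q + pd 1 (lagFluxR M a w (deriv w) G) q := by
      have hfun : multFluxR M a f h w G = (radMultFluxR M a f G + timeMultFluxR M a h G) +
          lagFluxR M a w (deriv w) G := rfl
      rw [hfun, pd_add hW₀ (G₁ := radMultFluxR M a f G + timeMultFluxR M a h G)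
        (G₂ := lagFluxR M a w (deriv w) G) (sRF.add sTF) sLF 1 hq, Pi.add_apply,
        pd_add hW₀ sRF sTF 1 hq, Pi.add_apply]
    have e2 : pd 2 (multFluxTheta f h w G) q =
        pd 2 (radMultFluxTheta f G) q + pd 2 (timeMultFluxTheta h G) q + pd 2 (lagFluxTheta w G) q := by
      have hfun : multFluxTheta f h w G = (radMultFluxTheta f G + timeMultFluxTheta h G) +
          lagFluxTheta w G := rfl
      rw [hfun, pd_add hW₀ (G₁ := radMultFluxTheta f G + timeMultFluxTheta h G)
        (G₂ := lagFluxTheta w G) (sRT.add sTT) sLT 2 hq, Pi.add_apply, pd_add hW₀ sRT sTT 2 hq,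
        Pi.add_apply]
    simp only [hDdef, e0, e1, e2, multBulk]
    linarith
  exact eq_zero_of_eq_zero_offAxis hW₀ hDc hD0

/-- **The `(f∂_r + h∂_{t*}, w)`-multiplier identity on a coordinate box, for solutions.** For `G`
smooth on an open `W₀` containing the box `[t₁, t₂] × [r₁, r₂] × [0, π]` (at `φ₀`), with
`𝓡G + 𝓐G = 0` off the axis on `W₀`, and smooth radial profiles `f, h, w`:
`∫∫ e(t₂) − ∫∫ e(t₁) + ∫_{t₁}^{t₂}∫∫ bulk + ∫_{t₁}^{t₂}∫₀^π (F(t, r₂, θ) − F(t, r₁, θ)) dθ dt = 0`,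
`e = multDensity`, `F = multFluxR`, `bulk = multBulk` (the polar fluxes vanish at the poles). This is
the energy identity of the current `J^{X,w}` on the region between two leaves and two cylinders in
the coordinates of Aretakis 2012, §8 (`box_divergence_identity` + `mult_divergence_eq_zero`).
[cite: Aretakis2012, §8] -/
theorem mult_box_identity {W₀ : Set E4} (hW₀ : IsOpen W₀) {G : E4 → ℝ}
    (hG : ContDiffOn ℝ ∞ G W₀) (hP : ∀ q ∈ W₀, sin (q 2) ≠ 0 → radOp M a G q + angOp a G q = 0)
    {f h w : ℝ → ℝ} (hf : ContDiff ℝ ∞ f) (hh : ContDiff ℝ ∞ h) (hw : ContDiff ℝ ∞ w)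
    {t₁ t₂ r₁ r₂ φ₀ : ℝ} (ht : t₁ ≤ t₂) (hr : r₁ ≤ r₂)
    (hbox : ∀ t ∈ Icc t₁ t₂, ∀ r ∈ Icc r₁ r₂, ∀ θ ∈ Icc 0 π, boxPoint φ₀ t r θ ∈ W₀) :
    (∫ θ in (0 : ℝ)..π, ∫ r in r₁..r₂, multDensity M a f h w G (boxPoint φ₀ t₂ r θ)) -
        (∫ θ in (0 : ℝ)..π, ∫ r in r₁..r₂, multDensity M a f h w G (boxPoint φ₀ t₁ r θ)) +
        (∫ t in t₁..t₂, ∫ θ in (0 : ℝ)..π, ∫ r in r₁..r₂, multBulk M a f h w G (boxPoint φ₀ t r θ)) +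
        (∫ t in t₁..t₂, ∫ θ in (0 : ℝ)..π,
          (multFluxR M a f h w G (boxPoint φ₀ t r₂ θ) - multFluxR M a f h w G (boxPoint φ₀ t r₁ θ))) = 0 := by
  obtain ⟨cD, cFl, cTh, cB⟩ := contDiffOn_mult (M := M) (a := a) hW₀ hG hf hh hw
  have hid := mult_divergence_eq_zero (M := M) (a := a) hW₀ hG hP hf hh hw
  -- `box_divergence_identity` for `e = −multDensity`, `b = −multBulk`
  have hid' : ∀ q ∈ W₀, pd 0 (-multDensity M a f h w G) q + (-multBulk M a f h w G) q =
      pd 1 (multFluxR M a f h w G) q + pd 2 (multFluxTheta f h w G) q := by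
    intro q hq
    rw [pd_neg, Pi.neg_apply]
    have := hid q hq
    linarith
  have hbox' := box_divergence_identity hW₀ cD.neg cFl cTh cB.neg hid' ht hr hbox
  -- the polar fluxes vanish at the poles
  have hpole : ∀ t r, multFluxTheta f h w G (boxPoint φ₀ t r π) - multFluxTheta f h w G (boxPoint φ₀ t r 0) = 0 := by
    intro t r
    simp only [multFluxTheta, radMultFluxTheta, timeMultFluxTheta, lagFluxTheta, tFluxTheta,
      boxPoint_apply_two, sin_pi, sin_zero, zero_mul, mul_zero, add_zero, sub_self]
  simp only [hpole, intervalIntegral.integral_zero, add_zero, Pi.neg_apply,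
    intervalIntegral.integral_neg] at hbox'
  linarith

end Assembly

/-- **The total polar flux vanishes at the poles** `θ = 0, π` (every term carries the factor
`sin θ`), so that the `θ`-boundary terms of `box_divergence_identity` drop out for the multiplier
currents (as used in `mult_box_identity`). [cite: Aretakis2012, §8] -/
theorem multFluxTheta_poles (f h w : ℝ → ℝ) (G : E4 → ℝ) (φ₀ t r : ℝ) :
    multFluxTheta f h w G (boxPoint φ₀ t r π) = 0 ∧ multFluxTheta f h w G (boxPoint φ₀ t r 0) = 0 := by
  constructor <;>
    simp only [multFluxTheta, radMultFluxTheta, timeMultFluxTheta, lagFluxTheta, tFluxTheta,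
      boxPoint_apply_two, sin_pi, sin_zero, zero_mul, mul_zero, add_zero]

end StarCoord

end Kerr

end Literature.Geometry.Lorentzian

end
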